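import Mathlib
import Summits.PneNP.PneNP.Theorems.OverlapGapAlgebraSearchHardWindowSequentialLocalTerms

/-!
# PneNP / OverlapGapAlgebra — `SearchHardWindow` / `SolvableImpliesStableSection`:
# SEQUENTIAL LOCAL RULES are ℓ²-stable (2/4, part d) — the second moment of increasing cones

Support for cruxes `stmt-PneNP-2460` and `stmt-PneNP-2463` (the sequential local rung). With
`T(Φ, v)` the number of variables reached from `v` by increasing co-occurrence chains in the
instance `Φ` of `F_k(n, m)` and `S₂(v) = ∑_Φ T(Φ, v)²`:

* `shwSeq_termB_tt`, `shwSeq_termB` — the hop term, summed over targets and hop patterns;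
* `shwSeq_S2_rec` — the RECURSION `S₂(v) ≤ N(1 + β) + (β(1 + k² + β)/n) ∑_{u > v} S₂(u)`,
  `β = mk²/n`, `N = #instances`;
* `shwSeq_S2_le` — by discrete Grönwall, `S₂(v) ≤ (1 + β) e^{β(1+k²+β)} · N` for every root `v`:
  the increasing cone of a uniformly random instance has BOUNDED SECOND MOMENT, uniformly in `n`
  and in the root (the discrete form of `M₂(t) = e^{2Δ(1-t)} + Δ ∫_t^1 M₂`, solved by
  `M₂ ≤ 2e^{2Δ}`; Cauchy–Schwarz replaces the independence of the idealised branching picture).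
No definitions; axioms `propext`, `Classical.choice`, `Quot.sound`.
-/

set_option linter.dupNamespace false -- `Summit.PneNP.PneNP.…`: summit = sub-problem (D-0017)

namespace Summit.PneNP.PneNP.Theorems

open Finset
open scoped Classical

section SeqMoment

variable {m k n : ℕ}

/-- **Term B, one hop.** For a hop pattern `(c, p, q)`:
`∑_Φ [(Φ c p).1 = v < (Φ c q).1] (1 + #hops_Φ(v)) T_{∖c}(Φ, (Φ c q).1)²
≤ (1 + k² + mk²/n)/n² · ∑_{u > v} S₂(u)`. -/
theorem shwSeq_termB_tt (hn : 1 ≤ n) (v : Fin n) (c : Fin m) (p q : Fin k) :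
    ∑ Φ : (Fin m → Fin k → Fin n × Bool), (if (Φ c p).1 = v ∧ v < (Φ c q).1 then
        (1 + ((((Finset.univ : Finset (Fin m × Fin k × Fin k)).filter fun tt =>
          (Φ tt.1 tt.2.1).1 = v ∧ v < (Φ tt.1 tt.2.2).1)).card : ℝ)) *
          ((((Finset.univ : Finset (Fin n)).filter fun ww => (∃ (ll : ℕ) (xx : ℕ → Fin n), xx 0 = ((Φ c q).1) ∧ xx ll = ww ∧ ∀ ss : ℕ, ss < ll →
          (xx ss < xx (ss + 1) ∧ ∃ cc ∈ ((Finset.univ : Finset (Fin m)).erase c), ∃ pp qq : Fin k,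
            (Φ cc pp).1 = xx ss ∧ (Φ cc qq).1 = xx (ss + 1)))).card : ℕ) : ℝ) ^ 2 else 0) ≤
      (1 + (k : ℝ) ^ 2 + (m : ℝ) * (k : ℝ) ^ 2 / n) / (n : ℝ) ^ 2 *
        ∑ u ∈ (Finset.univ : Finset (Fin n)).filter (fun u => v < u), (∑ Φ : (Fin m → Fin k → Fin n × Bool), ((((Finset.univ : Finset (Fin n)).filter fun ww => (∃ (ll : ℕ) (xx : ℕ → Fin n), xx 0 = u ∧ xx ll = ww ∧ ∀ ss : ℕ, ss < ll →
          (xx ss < xx (ss + 1) ∧ ∃ cc ∈ (Finset.univ : Finset (Fin m)), ∃ pp qq : Fin k,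
            (Φ cc pp).1 = xx ss ∧ (Φ cc qq).1 = xx (ss + 1)))).card : ℕ) : ℝ) ^ 2) := by
  -- insert the target `u = (Φ c q).1`
  set F : (Fin m → Fin k → Fin n × Bool) → Fin n → ℝ := fun Φ u => (1 + ((((Finset.univ : Finset (Fin m × Fin k × Fin k)).filter fun tt =>
          (Φ tt.1 tt.2.1).1 = v ∧ v < (Φ tt.1 tt.2.2).1)).card : ℝ)) *
      ((((Finset.univ : Finset (Fin n)).filter fun ww => (∃ (ll : ℕ) (xx : ℕ → Fin n), xx 0 = u ∧ xx ll = ww ∧ ∀ ss : ℕ, ss < ll →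
          (xx ss < xx (ss + 1) ∧ ∃ cc ∈ ((Finset.univ : Finset (Fin m)).erase c), ∃ pp qq : Fin k,
            (Φ cc pp).1 = xx ss ∧ (Φ cc qq).1 = xx (ss + 1)))).card : ℕ) : ℝ) ^ 2 with hF
  have hins : ∀ Φ : (Fin m → Fin k → Fin n × Bool), (if (Φ c p).1 = v ∧ v < (Φ c q).1 then F Φ (Φ c q).1 else 0) =
      ∑ u ∈ (Finset.univ : Finset (Fin n)).filter (fun u => v < u),
        (if (Φ c p).1 = v ∧ (Φ c q).1 = u then F Φ u else 0) := by
    intro Φ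
    by_cases hp : (Φ c p).1 = v
    · simp only [hp, true_and]
      rw [Finset.sum_ite_eq]
      by_cases hq : v < (Φ c q).1
      · rw [if_pos hq, if_pos (Finset.mem_filter.2 ⟨Finset.mem_univ _, hq⟩)]
      · rw [if_neg hq, if_neg (fun h => hq (Finset.mem_filter.1 h).2)]
    · simp only [hp, false_and, if_false, Finset.sum_const_zero]
  calc ∑ Φ : (Fin m → Fin k → Fin n × Bool), (if (Φ c p).1 = v ∧ v < (Φ c q).1 then F Φ (Φ c q).1 else 0)
      = ∑ Φ : (Fin m → Fin k → Fin n × Bool), ∑ u ∈ (Finset.univ : Finset (Fin n)).filter (fun u => v < u),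
          (if (Φ c p).1 = v ∧ (Φ c q).1 = u then F Φ u else 0) := Finset.sum_congr rfl fun Φ _ => hins Φ
    _ = ∑ u ∈ (Finset.univ : Finset (Fin n)).filter (fun u => v < u), ∑ Φ : (Fin m → Fin k → Fin n × Bool),
          (if (Φ c p).1 = v ∧ (Φ c q).1 = u then F Φ u else 0) := Finset.sum_comm
    _ ≤ ∑ u ∈ (Finset.univ : Finset (Fin n)).filter (fun u => v < u),
          (1 + (k : ℝ) ^ 2 + (m : ℝ) * (k : ℝ) ^ 2 / n) / (n : ℝ) ^ 2 * (∑ Φ : (Fin m → Fin k → Fin n × Bool), ((((Finset.univ : Finset (Fin n)).filter fun ww => (∃ (ll : ℕ) (xx : ℕ → Fin n), xx 0 = u ∧ xx ll = ww ∧ ∀ ss : ℕ, ss < ll →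
          (xx ss < xx (ss + 1) ∧ ∃ cc ∈ (Finset.univ : Finset (Fin m)), ∃ pp qq : Fin k,
            (Φ cc pp).1 = xx ss ∧ (Φ cc qq).1 = xx (ss + 1)))).card : ℕ) : ℝ) ^ 2) := by
        refine Finset.sum_le_sum fun u hu => ?_
        rw [Finset.mem_filter] at hu
        exact shwSeq_termB_u hn v u hu.2 c p q
    _ = (1 + (k : ℝ) ^ 2 + (m : ℝ) * (k : ℝ) ^ 2 / n) / (n : ℝ) ^ 2 *
        ∑ u ∈ (Finset.univ : Finset (Fin n)).filter (fun u => v < u), (∑ Φ : (Fin m → Fin k → Fin n × Bool), ((((Finset.univ : Finset (Fin n)).filter fun ww => (∃ (ll : ℕ) (xx : ℕ → Fin n), xx 0 = u ∧ xx ll = ww ∧ ∀ ss : ℕ, ss < ll →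
          (xx ss < xx (ss + 1) ∧ ∃ cc ∈ (Finset.univ : Finset (Fin m)), ∃ pp qq : Fin k,
            (Φ cc pp).1 = xx ss ∧ (Φ cc qq).1 = xx (ss + 1)))).card : ℕ) : ℝ) ^ 2) := by
        rw [Finset.mul_sum]

/-- **Term B.** `∑_Φ (1 + #hops_Φ(v)) ∑_{hops (c,p,q)} T_{∖c}(Φ, u_{cq})²
≤ mk² (1 + k² + mk²/n)/n² · ∑_{u > v} S₂(u)`. -/
theorem shwSeq_termB (hn : 1 ≤ n) (v : Fin n) :
    ∑ Φ : (Fin m → Fin k → Fin n × Bool), (1 + ((((Finset.univ : Finset (Fin m × Fin k × Fin k)).filter fun tt =>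
          (Φ tt.1 tt.2.1).1 = v ∧ v < (Φ tt.1 tt.2.2).1)).card : ℝ)) * ∑ tt ∈ ((Finset.univ : Finset (Fin m × Fin k × Fin k)).filter fun tt =>
          (Φ tt.1 tt.2.1).1 = v ∧ v < (Φ tt.1 tt.2.2).1),
        ((((Finset.univ : Finset (Fin n)).filter fun ww => (∃ (ll : ℕ) (xx : ℕ → Fin n), xx 0 = ((Φ tt.1 tt.2.2).1) ∧ xx ll = ww ∧ ∀ ss : ℕ, ss < ll →
          (xx ss < xx (ss + 1) ∧ ∃ cc ∈ ((Finset.univ : Finset (Fin m)).erase tt.1), ∃ pp qq : Fin k,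
            (Φ cc pp).1 = xx ss ∧ (Φ cc qq).1 = xx (ss + 1)))).card : ℕ) : ℝ) ^ 2 ≤
      (m : ℝ) * (k : ℝ) ^ 2 * ((1 + (k : ℝ) ^ 2 + (m : ℝ) * (k : ℝ) ^ 2 / n) / (n : ℝ) ^ 2) *
        ∑ u ∈ (Finset.univ : Finset (Fin n)).filter (fun u => v < u), (∑ Φ : (Fin m → Fin k → Fin n × Bool), ((((Finset.univ : Finset (Fin n)).filter fun ww => (∃ (ll : ℕ) (xx : ℕ → Fin n), xx 0 = u ∧ xx ll = ww ∧ ∀ ss : ℕ, ss < ll →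
          (xx ss < xx (ss + 1) ∧ ∃ cc ∈ (Finset.univ : Finset (Fin m)), ∃ pp qq : Fin k,
            (Φ cc pp).1 = xx ss ∧ (Φ cc qq).1 = xx (ss + 1)))).card : ℕ) : ℝ) ^ 2) := by
  set F : (Fin m → Fin k → Fin n × Bool) → Fin m × Fin k × Fin k → ℝ := fun Φ tt => (1 + ((((Finset.univ : Finset (Fin m × Fin k × Fin k)).filter fun tt =>
          (Φ tt.1 tt.2.1).1 = v ∧ v < (Φ tt.1 tt.2.2).1)).card : ℝ)) *
      ((((Finset.univ : Finset (Fin n)).filter fun ww => (∃ (ll : ℕ) (xx : ℕ → Fin n), xx 0 = ((Φ tt.1 tt.2.2).1) ∧ xx ll = ww ∧ ∀ ss : ℕ, ss < ll →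
          (xx ss < xx (ss + 1) ∧ ∃ cc ∈ ((Finset.univ : Finset (Fin m)).erase tt.1), ∃ pp qq : Fin k,
            (Φ cc pp).1 = xx ss ∧ (Φ cc qq).1 = xx (ss + 1)))).card : ℕ) : ℝ) ^ 2 with hF
  have hrew : ∀ Φ : (Fin m → Fin k → Fin n × Bool), (1 + ((((Finset.univ : Finset (Fin m × Fin k × Fin k)).filter fun tt =>
          (Φ tt.1 tt.2.1).1 = v ∧ v < (Φ tt.1 tt.2.2).1)).card : ℝ)) * ∑ tt ∈ ((Finset.univ : Finset (Fin m × Fin k × Fin k)).filter fun tt =>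
          (Φ tt.1 tt.2.1).1 = v ∧ v < (Φ tt.1 tt.2.2).1),
        ((((Finset.univ : Finset (Fin n)).filter fun ww => (∃ (ll : ℕ) (xx : ℕ → Fin n), xx 0 = ((Φ tt.1 tt.2.2).1) ∧ xx ll = ww ∧ ∀ ss : ℕ, ss < ll →
          (xx ss < xx (ss + 1) ∧ ∃ cc ∈ ((Finset.univ : Finset (Fin m)).erase tt.1), ∃ pp qq : Fin k,
            (Φ cc pp).1 = xx ss ∧ (Φ cc qq).1 = xx (ss + 1)))).card : ℕ) : ℝ) ^ 2 =
      ∑ tt : Fin m × Fin k × Fin k,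
        (if (Φ tt.1 tt.2.1).1 = v ∧ v < (Φ tt.1 tt.2.2).1 then F Φ tt else 0) := by
    intro Φ
    rw [Finset.mul_sum, ← Finset.sum_filter]
  rw [Finset.sum_congr rfl fun Φ _ => hrew Φ, Finset.sum_comm]
  have htt : ∀ tt : Fin m × Fin k × Fin k, ∑ Φ : (Fin m → Fin k → Fin n × Bool),
      (if (Φ tt.1 tt.2.1).1 = v ∧ v < (Φ tt.1 tt.2.2).1 then F Φ tt else 0) ≤
        (1 + (k : ℝ) ^ 2 + (m : ℝ) * (k : ℝ) ^ 2 / n) / (n : ℝ) ^ 2 *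
          ∑ u ∈ (Finset.univ : Finset (Fin n)).filter (fun u => v < u), (∑ Φ : (Fin m → Fin k → Fin n × Bool), ((((Finset.univ : Finset (Fin n)).filter fun ww => (∃ (ll : ℕ) (xx : ℕ → Fin n), xx 0 = u ∧ xx ll = ww ∧ ∀ ss : ℕ, ss < ll →
          (xx ss < xx (ss + 1) ∧ ∃ cc ∈ (Finset.univ : Finset (Fin m)), ∃ pp qq : Fin k,
            (Φ cc pp).1 = xx ss ∧ (Φ cc qq).1 = xx (ss + 1)))).card : ℕ) : ℝ) ^ 2) :=
    fun tt => shwSeq_termB_tt hn v tt.1 tt.2.1 tt.2.2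
  calc ∑ tt : Fin m × Fin k × Fin k, ∑ Φ : (Fin m → Fin k → Fin n × Bool),
        (if (Φ tt.1 tt.2.1).1 = v ∧ v < (Φ tt.1 tt.2.2).1 then F Φ tt else 0)
      ≤ ∑ _tt : Fin m × Fin k × Fin k, (1 + (k : ℝ) ^ 2 + (m : ℝ) * (k : ℝ) ^ 2 / n) / (n : ℝ) ^ 2 *
          ∑ u ∈ (Finset.univ : Finset (Fin n)).filter (fun u => v < u), (∑ Φ : (Fin m → Fin k → Fin n × Bool), ((((Finset.univ : Finset (Fin n)).filter fun ww => (∃ (ll : ℕ) (xx : ℕ → Fin n), xx 0 = u ∧ xx ll = ww ∧ ∀ ss : ℕ, ss < ll →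
          (xx ss < xx (ss + 1) ∧ ∃ cc ∈ (Finset.univ : Finset (Fin m)), ∃ pp qq : Fin k,
            (Φ cc pp).1 = xx ss ∧ (Φ cc qq).1 = xx (ss + 1)))).card : ℕ) : ℝ) ^ 2) :=
        Finset.sum_le_sum fun tt _ => htt tt
    _ = (m : ℝ) * (k : ℝ) ^ 2 * ((1 + (k : ℝ) ^ 2 + (m : ℝ) * (k : ℝ) ^ 2 / n) / (n : ℝ) ^ 2) *
        ∑ u ∈ (Finset.univ : Finset (Fin n)).filter (fun u => v < u), (∑ Φ : (Fin m → Fin k → Fin n × Bool), ((((Finset.univ : Finset (Fin n)).filter fun ww => (∃ (ll : ℕ) (xx : ℕ → Fin n), xx 0 = u ∧ xx ll = ww ∧ ∀ ss : ℕ, ss < ll →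
          (xx ss < xx (ss + 1) ∧ ∃ cc ∈ (Finset.univ : Finset (Fin m)), ∃ pp qq : Fin k,
            (Φ cc pp).1 = xx ss ∧ (Φ cc qq).1 = xx (ss + 1)))).card : ℕ) : ℝ) ^ 2) := by
        rw [Finset.sum_const, Finset.card_univ, nsmul_eq_mul, Fintype.card_prod, Fintype.card_prod,
          Fintype.card_fin, Fintype.card_fin]
        push_cast; ring

/-- **The recursion.** `S₂(v) ≤ N(1 + β) + (β(1 + k² + β)/n) ∑_{u > v} S₂(u)`, `β = mk²/n`. -/
theorem shwSeq_S2_rec (hn : 1 ≤ n) (v : Fin n) :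
    (∑ Φ : (Fin m → Fin k → Fin n × Bool), ((((Finset.univ : Finset (Fin n)).filter fun ww => (∃ (ll : ℕ) (xx : ℕ → Fin n), xx 0 = v ∧ xx ll = ww ∧ ∀ ss : ℕ, ss < ll →
          (xx ss < xx (ss + 1) ∧ ∃ cc ∈ (Finset.univ : Finset (Fin m)), ∃ pp qq : Fin k,
            (Φ cc pp).1 = xx ss ∧ (Φ cc qq).1 = xx (ss + 1)))).card : ℕ) : ℝ) ^ 2) ≤ (Fintype.card (Fin m → Fin k → Fin n × Bool) : ℝ) * (1 + (m : ℝ) * (k : ℝ) ^ 2 / n) +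
      ((m : ℝ) * (k : ℝ) ^ 2 / n) * (1 + (k : ℝ) ^ 2 + (m : ℝ) * (k : ℝ) ^ 2 / n) / n *
        ∑ u ∈ (Finset.univ : Finset (Fin n)).filter (fun u => v < u), (∑ Φ : (Fin m → Fin k → Fin n × Bool), ((((Finset.univ : Finset (Fin n)).filter fun ww => (∃ (ll : ℕ) (xx : ℕ → Fin n), xx 0 = u ∧ xx ll = ww ∧ ∀ ss : ℕ, ss < ll →
          (xx ss < xx (ss + 1) ∧ ∃ cc ∈ (Finset.univ : Finset (Fin m)), ∃ pp qq : Fin k,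
            (Φ cc pp).1 = xx ss ∧ (Φ cc qq).1 = xx (ss + 1)))).card : ℕ) : ℝ) ^ 2) := by
  have hnpos : (0 : ℝ) < n := by exact_mod_cast hn
  have hA := shwSeq_termA (m := m) (k := k) hn v
  have hB := shwSeq_termB (m := m) (k := k) hn v
  have hsq : (∑ Φ : (Fin m → Fin k → Fin n × Bool), ((((Finset.univ : Finset (Fin n)).filter fun ww => (∃ (ll : ℕ) (xx : ℕ → Fin n), xx 0 = v ∧ xx ll = ww ∧ ∀ ss : ℕ, ss < ll →
          (xx ss < xx (ss + 1) ∧ ∃ cc ∈ (Finset.univ : Finset (Fin m)), ∃ pp qq : Fin k,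
            (Φ cc pp).1 = xx ss ∧ (Φ cc qq).1 = xx (ss + 1)))).card : ℕ) : ℝ) ^ 2) ≤ ∑ Φ : (Fin m → Fin k → Fin n × Bool), ((1 + ((((Finset.univ : Finset (Fin m × Fin k × Fin k)).filter fun tt =>
          (Φ tt.1 tt.2.1).1 = v ∧ v < (Φ tt.1 tt.2.2).1)).card : ℝ)) +
      (1 + ((((Finset.univ : Finset (Fin m × Fin k × Fin k)).filter fun tt =>
          (Φ tt.1 tt.2.1).1 = v ∧ v < (Φ tt.1 tt.2.2).1)).card : ℝ)) * ∑ tt ∈ ((Finset.univ : Finset (Fin m × Fin k × Fin k)).filter fun tt =>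
          (Φ tt.1 tt.2.1).1 = v ∧ v < (Φ tt.1 tt.2.2).1),
        ((((Finset.univ : Finset (Fin n)).filter fun ww => (∃ (ll : ℕ) (xx : ℕ → Fin n), xx 0 = ((Φ tt.1 tt.2.2).1) ∧ xx ll = ww ∧ ∀ ss : ℕ, ss < ll →
          (xx ss < xx (ss + 1) ∧ ∃ cc ∈ ((Finset.univ : Finset (Fin m)).erase tt.1), ∃ pp qq : Fin k,
            (Φ cc pp).1 = xx ss ∧ (Φ cc qq).1 = xx (ss + 1)))).card : ℕ) : ℝ) ^ 2) := by
    refine Finset.sum_le_sum fun Φ _ => ?_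
    have h := shwSeq_T_sq_le Φ v
    linarith [h]
  rw [Finset.sum_add_distrib] at hsq
  have hcoef : (m : ℝ) * (k : ℝ) ^ 2 * ((1 + (k : ℝ) ^ 2 + (m : ℝ) * (k : ℝ) ^ 2 / n) / (n : ℝ) ^ 2) =
      ((m : ℝ) * (k : ℝ) ^ 2 / n) * (1 + (k : ℝ) ^ 2 + (m : ℝ) * (k : ℝ) ^ 2 / n) / n := by
    field_simp
  rw [hcoef] at hB
  linarith

/-- **Bounded second moment of increasing cones.** For every root `v`:
`S₂(v) = ∑_Φ T(Φ, v)² ≤ (1 + β) e^{β(1 + k² + β)} · N`, `β = mk²/n`. -/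
theorem shwSeq_S2_le (hn : 1 ≤ n) (v : Fin n) :
    (∑ Φ : (Fin m → Fin k → Fin n × Bool), ((((Finset.univ : Finset (Fin n)).filter fun ww => (∃ (ll : ℕ) (xx : ℕ → Fin n), xx 0 = v ∧ xx ll = ww ∧ ∀ ss : ℕ, ss < ll →
          (xx ss < xx (ss + 1) ∧ ∃ cc ∈ (Finset.univ : Finset (Fin m)), ∃ pp qq : Fin k,
            (Φ cc pp).1 = xx ss ∧ (Φ cc qq).1 = xx (ss + 1)))).card : ℕ) : ℝ) ^ 2) ≤ (1 + (m : ℝ) * (k : ℝ) ^ 2 / n) *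
      Real.exp (((m : ℝ) * (k : ℝ) ^ 2 / n) * (1 + (k : ℝ) ^ 2 + (m : ℝ) * (k : ℝ) ^ 2 / n)) *
        (Fintype.card (Fin m → Fin k → Fin n × Bool) : ℝ) := by
  have hnpos : (0 : ℝ) < n := by exact_mod_cast hn
  set β : ℝ := (m : ℝ) * (k : ℝ) ^ 2 / n with hβ
  have hβ0 : 0 ≤ β := by rw [hβ]; positivity
  set A : ℝ := (Fintype.card (Fin m → Fin k → Fin n × Bool) : ℝ) * (1 + β) with hAdef
  set B : ℝ := β * (1 + (k : ℝ) ^ 2 + β) with hBdef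
  have hA0 : 0 ≤ A := by rw [hAdef]; positivity
  have hB0 : 0 ≤ B := by rw [hBdef]; positivity
  -- the sequence on `ℕ`
  set f : ℕ → ℝ := fun i => if h : i < n then
      (∑ Φ : (Fin m → Fin k → Fin n × Bool), ((((Finset.univ : Finset (Fin n)).filter fun ww => (∃ (ll : ℕ) (xx : ℕ → Fin n), xx 0 = (⟨i, h⟩ : Fin n) ∧ xx ll = ww ∧ ∀ ss : ℕ, ss < ll →
          (xx ss < xx (ss + 1) ∧ ∃ cc ∈ (Finset.univ : Finset (Fin m)), ∃ pp qq : Fin k,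
            (Φ cc pp).1 = xx ss ∧ (Φ cc qq).1 = xx (ss + 1)))).card : ℕ) : ℝ) ^ 2) else 0
    with hf
  have hfv : ∀ u : Fin n, f u = (∑ Φ : (Fin m → Fin k → Fin n × Bool), ((((Finset.univ : Finset (Fin n)).filter fun ww => (∃ (ll : ℕ) (xx : ℕ → Fin n), xx 0 = u ∧ xx ll = ww ∧ ∀ ss : ℕ, ss < ll →
          (xx ss < xx (ss + 1) ∧ ∃ cc ∈ (Finset.univ : Finset (Fin m)), ∃ pp qq : Fin k,
            (Φ cc pp).1 = xx ss ∧ (Φ cc qq).1 = xx (ss + 1)))).card : ℕ) : ℝ) ^ 2) := by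
    intro u
    rw [hf]
    simp only [u.isLt, dif_pos]
  have hsum : ∀ w : Fin n, ∑ u ∈ (Finset.univ : Finset (Fin n)).filter (fun u => w < u), (∑ Φ : (Fin m → Fin k → Fin n × Bool), ((((Finset.univ : Finset (Fin n)).filter fun ww => (∃ (ll : ℕ) (xx : ℕ → Fin n), xx 0 = u ∧ xx ll = ww ∧ ∀ ss : ℕ, ss < ll →
          (xx ss < xx (ss + 1) ∧ ∃ cc ∈ (Finset.univ : Finset (Fin m)), ∃ pp qq : Fin k,
            (Φ cc pp).1 = xx ss ∧ (Φ cc qq).1 = xx (ss + 1)))).card : ℕ) : ℝ) ^ 2) =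
      ∑ j ∈ Finset.Ico ((w : ℕ) + 1) n, f j := by
    intro w
    have h1 : ∑ u ∈ (Finset.univ : Finset (Fin n)).filter (fun u => w < u), (∑ Φ : (Fin m → Fin k → Fin n × Bool), ((((Finset.univ : Finset (Fin n)).filter fun ww => (∃ (ll : ℕ) (xx : ℕ → Fin n), xx 0 = u ∧ xx ll = ww ∧ ∀ ss : ℕ, ss < ll →
          (xx ss < xx (ss + 1) ∧ ∃ cc ∈ (Finset.univ : Finset (Fin m)), ∃ pp qq : Fin k,
            (Φ cc pp).1 = xx ss ∧ (Φ cc qq).1 = xx (ss + 1)))).card : ℕ) : ℝ) ^ 2) =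
        ∑ u : Fin n, (if (w : ℕ) < u then f u else 0) := by
      rw [Finset.sum_filter]
      refine Finset.sum_congr rfl fun u _ => ?_
      rw [hfv u]
      have : (w < u) ↔ ((w : ℕ) < u) := Fin.lt_def
      by_cases hwu : w < u
      · rw [if_pos hwu, if_pos (this.1 hwu)]
      · rw [if_neg hwu, if_neg (fun h => hwu (this.2 h))]
    rw [h1, Fin.sum_univ_eq_sum_range (fun j => if (w : ℕ) < j then f j else 0) n, ← Finset.sum_filter]
    refine Finset.sum_congr ?_ fun _ _ => rfl
    ext j
    simp only [Finset.mem_filter, Finset.mem_range, Finset.mem_Ico]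
    omega
  have hrec : ∀ i, i < n → f i ≤ A + B / n * ∑ j ∈ Finset.Ico (i + 1) n, f j := by
    intro i hi
    have h := shwSeq_S2_rec (m := m) (k := k) hn ⟨i, hi⟩
    rw [hsum ⟨i, hi⟩] at h
    rw [hfv ⟨i, hi⟩, hAdef, hBdef, hβ]
    convert h using 2
  have hmain := shwSeq_gronwall n f A B hA0 hB0 hrec v v.isLt
  rw [hfv v] at hmain
  calc (∑ Φ : (Fin m → Fin k → Fin n × Bool), ((((Finset.univ : Finset (Fin n)).filter fun ww => (∃ (ll : ℕ) (xx : ℕ → Fin n), xx 0 = v ∧ xx ll = ww ∧ ∀ ss : ℕ, ss < ll →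
          (xx ss < xx (ss + 1) ∧ ∃ cc ∈ (Finset.univ : Finset (Fin m)), ∃ pp qq : Fin k,
            (Φ cc pp).1 = xx ss ∧ (Φ cc qq).1 = xx (ss + 1)))).card : ℕ) : ℝ) ^ 2) ≤ A * Real.exp B := hmain
    _ = (1 + β) * Real.exp B * (Fintype.card (Fin m → Fin k → Fin n × Bool) : ℝ) := by rw [hAdef]; ring


end SeqMoment

end Summit.PneNP.PneNP.Theorems
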